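import Summits.NavierStokesRegularity.NavierStokesRegularity.Theorems.OddMorawetzOddMorawetzLocalEPolySemantics
import Summits.NavierStokesRegularity.NavierStokesRegularity.Theorems.OddMorawetzOddMorawetzLocalNullLemmas
import Summits.NavierStokesRegularity.NavierStokesRegularity.Theorems.OddMorawetzOrderThreeIndefiniteGeneric
import HarnessLib

/-!
# Crux `OddMorawetzLocal` (stmt-NavierStokesRegularity-1376), refutation: the evaluator integrates by parts

Support file for the refutation skeleton of `OddMorawetzLocal` (line `registered`, lead c1), registered stub
`evaluator_ibp` (evaluator soundness, part 3 of 4).  Mathlib integration API plus landed tree theorems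
(`toP3_eEP`, `jetVal_pgv`, `jetVal_nil`, `integral_jetVal_eulerBilinear_cons_mul`, `fderiv_pgS_stdVec`,
`contDiff_jetVal`, `NullLemmas.integrable_lin_jetVal`, `NullLemmas.jet_bounds`, `stub_jetDecay`, `isSchwartzField_pgv`,
`isDivFree_pgv`, `integrable_pg`, `pg_mul`, `pg_add`, `pgv_apply`); no definitions, no named facts.

For an explicit divergence-free polynomial-Gaussian field `v = pgv 1 (toP3v P) = P e^{-|x|²}` with Euler
nonlinearity `b = B(v,v) = eulerBilinear v v`, and an integer cubic jet polynomial `p` (every monomial a product of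
three jet coordinates `∂^{l} v_a` of order `|l| ≤ 3`), the linearised Morawetz pairing is
`∫ lin p (Jv)(Jb) = Σ_{(c, w₀w₁w₂) ∈ p} Σ_s ∫ c · ∂^{l_s} b_{a_s} · ∏_{j ≠ s} ∂^{l_j} v_{a_j}` (Leibniz,
`prodDeriv_eq_sum`).  The two `v`-jets of a slot multiply to ONE rate-2 polynomial Gaussian
`(∏_{j≠s} dgList 1 l_j P_{a_j}) e^{-2|x|²}` (`jetVal_pgv`, `pg_mul`), and the `|l_s| ≤ 3` derivatives on the
bounded jet of `b` are integrated by parts onto it one at a time (`ibp_list`, from the tree's one-step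
`integral_jetVal_eulerBilinear_cons_mul`; the innermost new conjugated derivative is commuted to the outside,
`dg_comm`, since `∂ᵢ∂ⱼ = ∂ⱼ∂ᵢ` on polynomials), giving
`∫ b_{a_s} · [(−1)^{|l_s|} c · dgList 2 l_s (∏_{j≠s} dgList 1 l_j P_{a_j})] e^{-2|x|²}` (`slot`).  Summing the slots and
the terms (`term`, `integral_listSum_congr`; every summand is bounded × integrable) and reading the bracket as the
`a_s`-component of the kernel-computed Euler–Lagrange list `eEP p P` (`toP3_eEP`) yields
`∫ lin p (Jv)(Jb) = ∫ ⟪B(v,v), pgv 2 (toP3v (eEP p P))⟫`, the registered statement `evaluator_ibp`; its first part,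
integrability of the pairing integrand, is the tree's `NullLemmas.integrable_lin_jetVal`.
-/

noncomputable section

open MeasureTheory MvPolynomial
open scoped RealInnerProductSpace

-- the problem namespace `Summit.NavierStokesRegularity.NavierStokesRegularity` repeats the summit name by design (D-0017)
set_option linter.dupNamespace false
set_option autoImplicit false

namespace Summit.NavierStokesRegularity.NavierStokesRegularity.Theorems.OddMorawetz

namespace EvaluatorIBP

/-! ### Polynomial bookkeeping: commuting conjugated derivatives, constants -/

/-- Partial derivatives of polynomials commute. -/
theorem pderiv_pderiv_comm (i j : Fin 3) (q : P3) : pderiv i (pderiv j q) = pderiv j (pderiv i q) := by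
  -- adapted from Literature.RingTheory.MvPolynomial.HypersurfaceFunctionField (`pderiv_pderiv_comm`)
  induction q using MvPolynomial.induction_on with
  | C a => simp only [pderiv_C, map_zero]
  | add p q hp hq => simp only [map_add, hp, hq]
  | mul_X p n hp =>
    have key : ∀ i' j' : Fin 3, pderiv i' (pderiv j' (X n : P3)) = 0 := by
      intro i' j'
      rcases eq_or_ne n j' with rfl | h
      · rw [pderiv_X_self, pderiv_one]
      · rw [pderiv_X_of_ne h, map_zero]
    simp only [MvPolynomial.pderiv_mul, map_add, hp, key, mul_zero, add_zero]
    ring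

/-- **The conjugated derivatives commute**: `dg k i (dg k j q) = dg k j (dg k i q)`. -/
theorem dg_comm (k : ℕ) (i j : Fin 3) (q : P3) : dg k i (dg k j q) = dg k j (dg k i q) := by
  rcases eq_or_ne i j with rfl | hij
  · rfl
  simp only [dg, map_sub, MvPolynomial.pderiv_mul, pderiv_X_of_ne hij, pderiv_X_of_ne hij.symm, pderiv_ofNat',
    pderiv_natCast', pderiv_pderiv_comm i j q]
  ring

/-- An innermost conjugated derivative can be moved outside an iterated one. -/
theorem dgList_dg_comm (k : ℕ) (i : Fin 3) (q : P3) :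
    ∀ l : List (Fin 3), dgList k l (dg k i q) = dg k i (dgList k l q)
  | [] => rfl
  | j :: l => by rw [dgList_cons, dgList_dg_comm k i q l, dg_comm k j i, ← dgList_cons]

/-- `dg` is linear over constants. -/
theorem dg_C_mul (k : ℕ) (i : Fin 3) (c : ℝ) (q : P3) : dg k i (C c * q) = C c * dg k i q := by
  simp only [dg, pderiv_C_mul]
  ring

/-- `dgList` is linear over constants. -/
theorem dgList_C_mul (k : ℕ) (c : ℝ) (q : P3) :
    ∀ l : List (Fin 3), dgList k l (C c * q) = C c * dgList k l q
  | [] => rfl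
  | j :: l => by rw [dgList_cons, dgList_C_mul k c q l, dg_C_mul, ← dgList_cons]

/-! ### `pg` bookkeeping -/

/-- Constants come out of `pg`. -/
theorem pg_C_mul (k : ℕ) (c : ℝ) (q : P3) (x : E3) : pg k (C c * q) x = c * pg k q x := by
  rw [pg_def, pg_def, pev_mul, pev_C, mul_assoc]

/-- `pg` of a list sum. -/
theorem pg_listSum_map {ι : Type*} (k : ℕ) (f : ι → P3) (x : E3) :
    ∀ L : List ι, pg k (L.map f).sum x = (L.map fun i => pg k (f i) x).sum
  | [] => by simp
  | i :: L => by
    rw [List.map_cons, List.sum_cons, pg_add, pg_listSum_map k f x L, List.map_cons, List.sum_cons]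

/-- `pg` of an `if … then q else 0`. -/
theorem pg_ite (k : ℕ) (c : Prop) [Decidable c] (q : P3) (x : E3) :
    pg k (if c then q else 0) x = if c then pg k q x else 0 := by
  split_ifs <;> simp

/-- A finite sum over `Fin 3` commutes with a list sum (with a weight). -/
theorem sum_mul_listSum {ι : Type*} (u : Fin 3 → ℝ) (F : Fin 3 → ι → ℝ) :
    ∀ L : List ι, ∑ a, u a * (L.map (F a)).sum = (L.map fun i => ∑ a, u a * F a i).sum
  | [] => by simp
  | i :: L => by
    simp only [List.map_cons, List.sum_cons, mul_add, Finset.sum_add_distrib, sum_mul_listSum u F L]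

/-- The inner product with a rate-2 polynomial-Gaussian field, in coordinates. -/
theorem inner_pgv_two (u : E3) (Q : Fin 3 → P3) (x : E3) : ⟪u, pgv 2 Q x⟫ = ∑ a, u a * pg 2 (Q a) x := by
  rw [PiLp.inner_apply]
  refine Finset.sum_congr rfl fun a _ => ?_
  rw [RCLike.inner_apply', conj_trivial, pgv_apply]

/-! ### The Leibniz sum -/

/-- **Leibniz**: the linearisation of a monomial is the sum over its slots of (the direction at the slot) × (the
product of the values at the other slots). -/
theorem prodDeriv_eq_sum (ζ η : JVar → ℝ) : ∀ m : List JVar,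
    JPoly.prodDeriv m ζ η =
      ((List.finRange m.length).map fun s => η (m.get s) * ((m.eraseIdx s).map ζ).prod).sum
  | [] => by simp [JPoly.prodDeriv]
  | w :: ws => by
    simp only [JPoly.prodDeriv]
    rw [prodDeriv_eq_sum ζ η ws]
    dsimp only [List.length_cons]
    rw [List.finRange_succ]
    simp only [List.map_cons, List.sum_cons, List.map_map, Function.comp_def, List.get_cons_zero,
      List.get_cons_succ', Fin.val_zero, Fin.val_succ, List.eraseIdx_cons_zero, List.eraseIdx_cons_succ,
      List.prod_cons]
    rw [← List.sum_map_mul_left]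
    congr 1
    exact congrArg List.sum (List.map_congr_left fun s _ => by ring)

/-! ### The explicit field: jets and their products -/

section Field

variable (P : EField)

/-- Jets of `v = pgv 1 (toP3v P)`: `∂^l v_a = (dgList 1 l (toP3 (P a))) e^{-|x|²}`. -/
theorem jetVal_v (x : E3) (w : JVar) :
    jetVal (pgv 1 (toP3v P)) x w = pg 1 (dgList 1 w.2 (EPoly.toP3 (P w.1))) x :=
  jetVal_pgv 1 (toP3v P) w.1 w.2 x

/-- A product of `n` jets of `v` is the rate-`n` polynomial Gaussian of the product of their polynomials. -/
theorem prod_jetVal_v (x : E3) : ∀ L : List JVar,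
    (L.map (jetVal (pgv 1 (toP3v P)) x)).prod =
      pg L.length ((L.map fun w => dgList 1 w.2 (EPoly.toP3 (P w.1))).prod) x
  | [] => by simp [pg_def]
  | w :: L => by
    rw [List.map_cons, List.prod_cons, prod_jetVal_v x L, List.map_cons, List.prod_cons, List.length_cons,
      jetVal_v P x w, pg_mul, Nat.add_comm]

end Field

/-! ### `B(v,v)`: bounded jets, integrability against polynomial Gaussians, iterated integration by parts -/

section Bvv

open Literature.Analysis.FluidPDE

variable {v : E3 → E3}

/-- The jets of `B(v,v)` of order `≤ 4` are bounded (`NullLemmas.jet_bounds`). -/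
theorem exists_bound_jetVal (hv : IsSchwartzField v) (hd : VectorCalculus.IsDivFree v) :
    ∃ M : ℝ, ∀ w : JVar, w.2.length ≤ 4 → ∀ x, ‖jetVal (eulerBilinear v v) x w‖ ≤ M := by
  obtain ⟨M, hM0, -, hB⟩ := NullLemmas.jet_bounds hv hd
  refine ⟨M, fun w hw x => ?_⟩
  rw [Real.norm_eq_abs]
  calc |jetVal (eulerBilinear v v) x w| ≤ M * ((1 + ‖x‖) ^ 4)⁻¹ := hB w hw x
    _ ≤ M := mul_le_of_le_one_right hM0
        (inv_le_one_of_one_le₀ (one_le_pow₀ (by linarith [norm_nonneg x])))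

/-- A jet of `B(v,v)` of order `≤ 4` times a polynomial Gaussian is integrable (bounded × integrable). -/
theorem integrable_jetVal_mul_pg (hv : IsSchwartzField v) (hd : VectorCalculus.IsDivFree v) (w : JVar)
    (hw : w.2.length ≤ 4) (q : P3) :
    Integrable fun x => jetVal (eulerBilinear v v) x w * pg 2 q x := by
  obtain ⟨M, hM⟩ := exists_bound_jetVal hv hd
  obtain ⟨hb, -⟩ := stub_jetDecay v hv hd
  exact (integrable_pg 2 two_pos q).bdd_mul (contDiff_jetVal hb w).continuous.aestronglyMeasurable
    (ae_of_all _ (hM w hw))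

/-- **Iterated integration by parts**: all `|l| ≤ 3` derivatives of the jet `∂^l b_a` move onto the polynomial
Gaussian, `∫ ∂^l b_a · q e^{-2|x|²} = (-1)^{|l|} ∫ b_a · (dgList 2 l q) e^{-2|x|²}` (one step is the tree's
`integral_jetVal_eulerBilinear_cons_mul`; the innermost new `dg` is commuted outside by `dgList_dg_comm`). -/
theorem ibp_list (hv : IsSchwartzField v) (hd : VectorCalculus.IsDivFree v) (a : Fin 3) :
    ∀ l : List (Fin 3), l.length ≤ 3 → ∀ q : P3,
      ∫ x, jetVal (eulerBilinear v v) x (a, l) * pg 2 q x =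
        (-1 : ℝ) ^ l.length * ∫ x, eulerBilinear v v x a * pg 2 (dgList 2 l q) x
  | [], _, q => by simp [jetVal_nil]
  | i :: l, hl, q => by
    have hl' : l.length ≤ 3 := by simp only [List.length_cons] at hl; omega
    have h1 := integral_jetVal_eulerBilinear_cons_mul v hv hd (pgS 2 q) a i l hl'
    simp_rw [fderiv_pgS_stdVec 2 two_pos, pgS_apply 2 two_pos] at h1
    rw [h1, ibp_list hv hd a l hl' (dg 2 i q), dgList_dg_comm, ← dgList_cons, List.length_cons, pow_succ]
    ring

/-- `ibp_list` for a jet variable `w = (a, l)`. -/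
theorem ibp_jet (hv : IsSchwartzField v) (hd : VectorCalculus.IsDivFree v) (w : JVar) (hw : w.2.length ≤ 3)
    (q : P3) :
    ∫ x, jetVal (eulerBilinear v v) x w * pg 2 q x =
      (-1 : ℝ) ^ w.2.length * ∫ x, eulerBilinear v v x w.1 * pg 2 (dgList 2 w.2 q) x :=
  ibp_list hv hd w.1 w.2 hw q

end Bvv

/-! ### Sums of integrals -/

/-- Termwise equality of integrals of integrable summands gives equality of the integrals of the list sums
(and their integrability). -/
theorem integral_listSum_congr {ι : Type*} (f g : ι → E3 → ℝ) : ∀ L : List ι,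
    (∀ i ∈ L, Integrable (f i) ∧ Integrable (g i) ∧ ∫ x, f i x = ∫ x, g i x) →
    Integrable (fun x => (L.map fun i => f i x).sum) ∧ Integrable (fun x => (L.map fun i => g i x).sum) ∧
      ∫ x, (L.map fun i => f i x).sum = ∫ x, (L.map fun i => g i x).sum
  | [], _ => by simp
  | i :: L, h => by
    obtain ⟨hf, hg, hfg⟩ := h i List.mem_cons_self
    obtain ⟨hF, hG, hFG⟩ := integral_listSum_congr f g L fun j hj => h j (List.mem_cons_of_mem _ hj)
    simp only [List.map_cons, List.sum_cons]
    refine ⟨hf.add hF, hg.add hG, ?_⟩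
    rw [integral_add hf hF, integral_add hg hG, hfg, hFG]

/-! ### One slot, one term -/

section Slots

open Literature.Analysis.FluidPDE

variable (P : EField) (hdiv : ∑ i, dg 1 i (toP3v P i) = 0)
include hdiv

/-- **One slot**: for a monomial `m` of length `3` (jet orders `≤ 3`), coefficient `c` and slot `s`,
`∫ c · ∂^{l_s} b_{a_s} · ∏_{j ≠ s} ∂^{l_j} v_{a_j}
  = ∫ b_{a_s} · [(−1)^{|l_s|} c · dgList 2 l_s (∏_{j≠s} dgList 1 l_j P_{a_j})] e^{-2|x|²}`
(the two `v`-jets multiply to a rate-2 polynomial Gaussian, then `ibp_jet`). -/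
theorem slot (c : ℤ) (m : List JVar) (hm : m.length = 3) (hw : ∀ w ∈ m, w.2.length ≤ 3) (s : Fin m.length) :
    Integrable (fun x => (c : ℝ) *
        (jetVal (eulerBilinear (pgv 1 (toP3v P)) (pgv 1 (toP3v P))) x (m.get s) *
          ((m.eraseIdx s).map (jetVal (pgv 1 (toP3v P)) x)).prod)) ∧
    Integrable (fun x => eulerBilinear (pgv 1 (toP3v P)) (pgv 1 (toP3v P)) x (m.get s).1 *
        pg 2 (C (((-1 : ℚ) ^ (m.get s).2.length * (c : ℚ) : ℚ) : ℝ) *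
          dgList 2 (m.get s).2 (((m.eraseIdx s).map fun w => dgList 1 w.2 (EPoly.toP3 (P w.1))).prod)) x) ∧
    ∫ x, (c : ℝ) *
        (jetVal (eulerBilinear (pgv 1 (toP3v P)) (pgv 1 (toP3v P))) x (m.get s) *
          ((m.eraseIdx s).map (jetVal (pgv 1 (toP3v P)) x)).prod) =
      ∫ x, eulerBilinear (pgv 1 (toP3v P)) (pgv 1 (toP3v P)) x (m.get s).1 *
        pg 2 (C (((-1 : ℚ) ^ (m.get s).2.length * (c : ℚ) : ℚ) : ℝ) *
          dgList 2 (m.get s).2 (((m.eraseIdx s).map fun w => dgList 1 w.2 (EPoly.toP3 (P w.1))).prod)) x := by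
  have hv := isSchwartzField_pgv 1 one_pos (toP3v P)
  have hd := isDivFree_pgv (toP3v P) hdiv
  have hws : (m.get s).2.length ≤ 3 := hw _ (List.get_mem m s)
  have hlen : (m.eraseIdx s).length = 2 := by rw [List.length_eraseIdx_of_lt s.2, hm]
  have hfun : (fun x => (c : ℝ) *
      (jetVal (eulerBilinear (pgv 1 (toP3v P)) (pgv 1 (toP3v P))) x (m.get s) *
        ((m.eraseIdx s).map (jetVal (pgv 1 (toP3v P)) x)).prod)) =
      fun x => jetVal (eulerBilinear (pgv 1 (toP3v P)) (pgv 1 (toP3v P))) x (m.get s) *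
        pg 2 (C (c : ℝ) * ((m.eraseIdx s).map fun w => dgList 1 w.2 (EPoly.toP3 (P w.1))).prod) x := by
    funext x
    rw [prod_jetVal_v P x, hlen, pg_C_mul]
    ring
  rw [hfun]
  refine ⟨integrable_jetVal_mul_pg hv hd _ (by omega) _, ?_, ?_⟩
  · simpa only [jetVal_nil] using integrable_jetVal_mul_pg hv hd ((m.get s).1, []) (by simp) _
  rw [ibp_jet hv hd (m.get s) hws, dgList_C_mul, ← integral_const_mul]
  congr 1
  funext x
  rw [pg_C_mul, pg_C_mul]
  push_cast
  ring

/-- **One term**: for a term `(c, m)` with `|m| = 3` and jet orders `≤ 3`, the integral of `c · prodDeriv m (Jv)(Jb)`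
is the integral of the sum over the slots of `b_{a_s} · (E-field contribution of the slot) e^{-2|x|²}`. -/
theorem term (t : ℤ × List JVar) (ht : t.2.length = 3) (hw : ∀ w ∈ t.2, w.2.length ≤ 3) :
    Integrable (fun x => (t.1 : ℝ) * JPoly.prodDeriv t.2 (jetVal (pgv 1 (toP3v P)) x)
        (jetVal (eulerBilinear (pgv 1 (toP3v P)) (pgv 1 (toP3v P))) x)) ∧
    Integrable (fun x => ((List.finRange t.2.length).map fun s =>
        eulerBilinear (pgv 1 (toP3v P)) (pgv 1 (toP3v P)) x (t.2.get s).1 *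
          pg 2 (C (((-1 : ℚ) ^ (t.2.get s).2.length * (t.1 : ℚ) : ℚ) : ℝ) *
            dgList 2 (t.2.get s).2
              (((t.2.eraseIdx s).map fun w => dgList 1 w.2 (EPoly.toP3 (P w.1))).prod)) x).sum) ∧
    ∫ x, (t.1 : ℝ) * JPoly.prodDeriv t.2 (jetVal (pgv 1 (toP3v P)) x)
        (jetVal (eulerBilinear (pgv 1 (toP3v P)) (pgv 1 (toP3v P))) x) =
      ∫ x, ((List.finRange t.2.length).map fun s =>
        eulerBilinear (pgv 1 (toP3v P)) (pgv 1 (toP3v P)) x (t.2.get s).1 *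
          pg 2 (C (((-1 : ℚ) ^ (t.2.get s).2.length * (t.1 : ℚ) : ℚ) : ℝ) *
            dgList 2 (t.2.get s).2
              (((t.2.eraseIdx s).map fun w => dgList 1 w.2 (EPoly.toP3 (P w.1))).prod)) x).sum := by
  have hfun : (fun x => (t.1 : ℝ) * JPoly.prodDeriv t.2 (jetVal (pgv 1 (toP3v P)) x)
      (jetVal (eulerBilinear (pgv 1 (toP3v P)) (pgv 1 (toP3v P))) x)) =
      fun x => ((List.finRange t.2.length).map fun s => (t.1 : ℝ) *
        (jetVal (eulerBilinear (pgv 1 (toP3v P)) (pgv 1 (toP3v P))) x (t.2.get s) *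
          ((t.2.eraseIdx s).map (jetVal (pgv 1 (toP3v P)) x)).prod)).sum := by
    funext x
    rw [prodDeriv_eq_sum, List.sum_map_mul_left]
  rw [hfun]
  exact integral_listSum_congr _ _ _ fun s _ => slot P hdiv t.1 t.2 ht hw s

end Slots

end EvaluatorIBP

open EvaluatorIBP in
/-- **Stub `evaluator_ibp` of crux `OddMorawetzLocal`** (refutation skeleton; evaluator soundness 3/4).
For an explicit divergence-free polynomial-Gaussian field `v = pgv 1 (toP3v P)` and an integer cubic jet polynomial
`p` (monomials of length `3`, jet orders `≤ 3`): the linearised pairing `x ↦ lin p (Jv x) (J B(v,v) x)` is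
integrable, and its integral equals the pairing `∫ ⟪B(v,v), pgv 2 (toP3v (eEP p P))⟫` of `B(v,v)` with the explicit
Euler–Lagrange test field computed by the kernel pipeline `eEP` — each slot of each monomial is integrated by parts
`|l|` times onto the product of the other two jets (`ibp_list`), which is what `eEP` lists (`toP3_eEP`). -/
theorem evaluator_ibp (P : EField) (hdiv : ∑ i, dg 1 i (toP3v P i) = 0) (p : JPoly ℤ)
    (hp : ∀ t ∈ p, t.2.length = 3 ∧ ∀ w ∈ t.2, w.2.length ≤ 3) :
    Integrable (fun x => JPoly.lin (p.map fun t => ((t.1 : ℝ), t.2)) (jetVal (pgv 1 (toP3v P)) x)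
        (jetVal (Literature.Analysis.FluidPDE.eulerBilinear (pgv 1 (toP3v P)) (pgv 1 (toP3v P))) x)) ∧
    ∫ x, JPoly.lin (p.map fun t => ((t.1 : ℝ), t.2)) (jetVal (pgv 1 (toP3v P)) x)
        (jetVal (Literature.Analysis.FluidPDE.eulerBilinear (pgv 1 (toP3v P)) (pgv 1 (toP3v P))) x) =
      ∫ x, ⟪Literature.Analysis.FluidPDE.eulerBilinear (pgv 1 (toP3v P)) (pgv 1 (toP3v P)) x,
        pgv 2 (toP3v (eEP p P)) x⟫ := by
  have hv := isSchwartzField_pgv 1 one_pos (toP3v P)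
  have hd := isDivFree_pgv (toP3v P) hdiv
  refine ⟨NullLemmas.integrable_lin_jetVal hv hd _ fun t ht w hw => ?_, ?_⟩
  · obtain ⟨t', ht', rfl⟩ := List.mem_map.1 ht
    exact ((hp t' ht').2 w hw).trans (by norm_num)
  obtain ⟨-, -, key⟩ := integral_listSum_congr
    (fun (t : ℤ × List JVar) x => (t.1 : ℝ) * JPoly.prodDeriv t.2 (jetVal (pgv 1 (toP3v P)) x)
      (jetVal (Literature.Analysis.FluidPDE.eulerBilinear (pgv 1 (toP3v P)) (pgv 1 (toP3v P))) x))
    (fun (t : ℤ × List JVar) x => ((List.finRange t.2.length).map fun s =>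
      Literature.Analysis.FluidPDE.eulerBilinear (pgv 1 (toP3v P)) (pgv 1 (toP3v P)) x (t.2.get s).1 *
        pg 2 (C (((-1 : ℚ) ^ (t.2.get s).2.length * (t.1 : ℚ) : ℚ) : ℝ) *
          dgList 2 (t.2.get s).2
            (((t.2.eraseIdx s).map fun w => dgList 1 w.2 (EPoly.toP3 (P w.1))).prod)) x).sum)
    p fun t ht => term P hdiv t (hp t ht).1 (hp t ht).2
  have hL : ∀ x, JPoly.lin (p.map fun t => ((t.1 : ℝ), t.2)) (jetVal (pgv 1 (toP3v P)) x)
      (jetVal (Literature.Analysis.FluidPDE.eulerBilinear (pgv 1 (toP3v P)) (pgv 1 (toP3v P))) x) =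
      (p.map fun t => (t.1 : ℝ) * JPoly.prodDeriv t.2 (jetVal (pgv 1 (toP3v P)) x)
        (jetVal (Literature.Analysis.FluidPDE.eulerBilinear (pgv 1 (toP3v P)) (pgv 1 (toP3v P))) x)).sum := by
    intro x
    simp only [JPoly.lin, List.map_map, Function.comp_def]
  have hR : ∀ x, ⟪Literature.Analysis.FluidPDE.eulerBilinear (pgv 1 (toP3v P)) (pgv 1 (toP3v P)) x,
      pgv 2 (toP3v (eEP p P)) x⟫ =
      (p.map fun t => ((List.finRange t.2.length).map fun s =>
        Literature.Analysis.FluidPDE.eulerBilinear (pgv 1 (toP3v P)) (pgv 1 (toP3v P)) x (t.2.get s).1 *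
          pg 2 (C (((-1 : ℚ) ^ (t.2.get s).2.length * (t.1 : ℚ) : ℚ) : ℝ) *
            dgList 2 (t.2.get s).2
              (((t.2.eraseIdx s).map fun w => dgList 1 w.2 (EPoly.toP3 (P w.1))).prod)) x).sum).sum := by
    intro x
    rw [inner_pgv_two]
    simp_rw [toP3v, toP3_eEP, pg_listSum_map, pg_ite, sum_mul_listSum]
    refine congrArg List.sum (List.map_congr_left fun t _ => ?_)
    refine congrArg List.sum (List.map_congr_left fun s _ => ?_)
    simp only [mul_ite, mul_zero, Finset.sum_ite_eq, Finset.mem_univ, if_true]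
  simp_rw [hL, hR]
  exact key

end Summit.NavierStokesRegularity.NavierStokesRegularity.Theorems.OddMorawetz

end
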